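import Summits.CriticalPhenomena.PercolationContinuityZ3.Theorems.PercNearOneGluingNoHeavyLowerTailAntitheticOneSidedCubes
import Summits.CriticalPhenomena.PercolationContinuityZ3.Theorems.PercNearOneGluingNoHeavyLowerTailAntitheticTermOne
import Summits.CriticalPhenomena.PercolationContinuityZ3.Theorems.PercNearOneGluingNoHeavyLowerTailAntitheticCycleRuns
import HarnessLib

/-!
# `NoHeavyLowerTail` (stmt-CriticalPhenomena-4575) — antithetic cluster pairs: RED-DOMINATED BOXES of the colouring cube (the cells of
# THEOREM ⊕-CYCLE and of PR4; HOME/THEOREM-Theta.md §2, prim-hp-2 gen 62)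

Support file (`--supports stmt-CriticalPhenomena-4575`, hull-port prover `prim-hp-2`, gen 62).  No definitions, no named facts, no sorries;
standard axioms.  VERTEX version; notation of …AntitheticTermOne / …AntitheticPendant: colourings `T ⊆ Sym2 V` (all pairs, edges or not),
edge set `E`, source `s`, `X T = openCluster (T ∩ E) s` (red cluster), `Y T = openCluster (Tᶜ ∩ E) s` (blue cluster).

A BOX is a sub-cube `{T : T agrees with the pattern N on the fixed pairs Fix}` of the colouring cube; its ANTIPODE map is `T ↦ T'` with
`T'` agreeing with `T` on `Fix` and opposite to `T` off `Fix`.  The box is RED-DOMINATED if `Y T' ⊆ X T` for every member `T`.  Since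
`T ↦ X T` is monotone and `T ↦ Y T` antitone along any sub-cube, a red-dominated box is a one-sided cube in the sense of
`Antithetic.superodd_cube_sum_nonneg` (…AntitheticOneSidedCubes), hence:
* `Antithetic.Box.box_sum_nonneg` — on a red-dominated box, `Σ_T K₁(X T, Y T)·K₂(X T, Y T) ≥ 0` for super-odd twisted-monotone `K₁, K₂`.
* `Antithetic.Box.boxes_sum_nonneg` — an event partitioned into red-dominated boxes (cover / inside / uniqueness) has nonnegative sum for
  all super-odd twisted-monotone `K₁, K₂`; with the event `{P ∈ X T}` this is "`(E, s, P)` is ⊕-POSITIVE" in the form consumed by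
  `Antithetic.oplus_composition_sum_nonneg` / `Antithetic.DegTwo.cutVertex_vertex_sum_nonneg` (the class 𝒦⁺ of HOME/THEOREM-OneSided.md).
* `Antithetic.Box.dom_insert_leaf`, `Antithetic.Box.mem_insert_leaf_iff` — red-domination and the event `{P ∈ X}` are unchanged when a pendant
  pair `Qw` (fresh leaf `w`) is added to `E` and left free; `Antithetic.Box.mem_path_iff`, `Antithetic.Box.dom_path` — the same along a
  pendant PATH `w 0 – w 1 – … – w j` of fresh vertices hanging at `w 0` (edge set `E ∪ Cyc.edgeSet j w`): box decompositions are stable under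
  hanging pendant paths (used for the cycle with a pendant stub in THEOREM Θ).
[cite: VandenbergHaggstromKahn2005, §1 p. 6 ("Harris' inequality"), §1 p. 3 (open cluster `C_s`)]
-/

noncomputable section

namespace Summit.CriticalPhenomena.PercolationContinuityZ3.Theorems

open Literature.Probability.Percolation
open scoped Classical

namespace Antithetic

namespace Box

variable {V : Type*} [Fintype V]

open Freeze in
/-- **Box lemma.**  `Fix, N ⊆ Sym2 V` (fixed pairs and their pattern); the box is `{T : ∀ e ∈ Fix, e ∈ T ↔ e ∈ N}`.  If for all members
`T, T'` that are opposite off `Fix` the blue cluster of `T'` lies inside the red cluster of `T` (RED DOMINATION), then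
`0 ≤ Σ_{T ∈ box} K₁(X T, Y T)·K₂(X T, Y T)` for all super-odd twisted-monotone `K₁, K₂`. [this work] -/
theorem box_sum_nonneg (E : Set (Sym2 V)) (s : V) (Fix N : Set (Sym2 V))
    (hdom : ∀ T T' : Set (Sym2 V), (∀ e ∈ Fix, (e ∈ T ↔ e ∈ N)) → (∀ e ∈ Fix, (e ∈ T' ↔ e ∈ N)) →
      (∀ e ∉ Fix, (e ∈ T' ↔ e ∉ T)) → openCluster (T'ᶜ ∩ E) s ⊆ openCluster (T ∩ E) s)
    {K₁ K₂ : Set V → Set V → ℝ}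
    (hK₁ : ∀ ⦃P P' Q Q' : Set V⦄, P ⊆ P' → Q' ⊆ Q → K₁ P Q ≤ K₁ P' Q') (hso₁ : ∀ P Q, 0 ≤ K₁ P Q + K₁ Q P)
    (hK₂ : ∀ ⦃P P' Q Q' : Set V⦄, P ⊆ P' → Q' ⊆ Q → K₂ P Q ≤ K₂ P' Q') (hso₂ : ∀ P Q, 0 ≤ K₂ P Q + K₂ Q P) :
    0 ≤ ∑ T ∈ Finset.univ.filter (fun T : Set (Sym2 V) => ∀ e ∈ Fix, (e ∈ T ↔ e ∈ N)),
      K₁ (openCluster (T ∩ E) s) (openCluster (Tᶜ ∩ E) s) * K₂ (openCluster (T ∩ E) s) (openCluster (Tᶜ ∩ E) s) := by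
  -- notation
  let X : Set (Sym2 V) → Set V := fun T => openCluster (T ∩ E) s
  let Y : Set (Sym2 V) → Set V := fun T => openCluster (Tᶜ ∩ E) s
  let Ψ : Set (Sym2 V) → ℝ := fun T => K₁ (X T) (Y T) * K₂ (X T) (Y T)
  let mem : Set (Sym2 V) → Prop := fun T => ∀ e ∈ Fix, (e ∈ T ↔ e ∈ N)
  show 0 ≤ ∑ T ∈ Finset.univ.filter (fun T => mem T), Ψ T
  have hXmono : Monotone X := fun T T' h => openCluster_mono (Set.inter_subset_inter_left E h) s
  have hYanti : Antitone Y := fun T T' h =>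
    openCluster_mono (Set.inter_subset_inter_left E (Set.compl_subset_compl.2 h)) s
  -- parametrise the box by the free pairs
  let ι := {e : Sym2 V // e ∉ Fix}
  let base : Set (Sym2 V) := N ∩ Fix
  let emb : Set ι → Set (Sym2 V) := fun S => base ∪ {e | ∃ h : e ∉ Fix, (⟨e, h⟩ : ι) ∈ S}
  let proj : Set (Sym2 V) → Set ι := fun T => {p | p.1 ∈ T}
  have hemb_mono : Monotone emb := by
    intro S S' h e he
    rcases he with he | ⟨hne, hmem⟩
    · exact Or.inl he
    · exact Or.inr ⟨hne, h hmem⟩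
  have hemb_mem : ∀ S, mem (emb S) := by
    intro S e he
    constructor
    · rintro (h | ⟨hne, _⟩)
      · exact h.1
      · exact absurd he hne
    · exact fun h => Or.inl ⟨h, he⟩
  have hemb_off : ∀ S (e : Sym2 V) (h : e ∉ Fix), e ∈ emb S ↔ (⟨e, h⟩ : ι) ∈ S := by
    intro S e h
    constructor
    · rintro (h' | ⟨_, h'⟩)
      · exact absurd h'.2 h
      · exact h'
    · exact fun h' => Or.inr ⟨h, h'⟩
  -- antipodal domination of the parametrised cube
  have hdom' : ∀ S : Set ι, Y (emb Sᶜ) ⊆ X (emb S) := by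
    intro S
    refine hdom (emb S) (emb Sᶜ) (hemb_mem S) (hemb_mem Sᶜ) fun e he => ?_
    rw [hemb_off Sᶜ e he, hemb_off S e he, Set.mem_compl_iff]
  have hcube := superodd_cube_sum_nonneg (fun S : Set ι => X (emb S)) (fun S : Set ι => Y (emb S))
    (fun S S' h => hXmono (hemb_mono h)) (fun S S' h => hYanti (hemb_mono h)) hdom' hK₁ hso₁ hK₂ hso₂
  -- transport the cube sum to the box
  have hbij : ∑ S : Set ι, Ψ (emb S) = ∑ T ∈ Finset.univ.filter (fun T => mem T), Ψ T := by
    refine Finset.sum_nbij' emb proj ?_ ?_ ?_ ?_ ?_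
    · intro S _
      exact Finset.mem_filter.2 ⟨Finset.mem_univ _, hemb_mem S⟩
    · intro T _; exact Finset.mem_univ _
    · intro S _
      ext p
      simp only [proj, Set.mem_setOf_eq]
      exact hemb_off S p.1 p.2
    · intro T hT
      have hT' : mem T := (Finset.mem_filter.1 hT).2
      ext e
      by_cases he : e ∈ Fix
      · rw [hT' e he]
        constructor
        · rintro (h | ⟨hne, _⟩)
          · exact h.1
          · exact absurd he hne
        · exact fun h => Or.inl ⟨h, he⟩
      · rw [hemb_off (proj T) e he]
        rfl
    · intro S _; rfl
  rw [← hbij]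
  exact hcube

/-- **Partition into red-dominated boxes.**  `D` an event (finite set of colourings), boxes `(Fix c, N c)` indexed by `c : C` such that every
`T ∈ D` lies in some box (cover), every box lies in `D` (inside), no colouring lies in two boxes (uniqueness), and every box is red-dominated.
Then `0 ≤ Σ_{T ∈ D} K₁(X T, Y T)·K₂(X T, Y T)` for all super-odd twisted-monotone `K₁, K₂`. [this work] -/
theorem boxes_sum_nonneg {C : Type*} (E : Set (Sym2 V)) (s : V) (D : Finset (Set (Sym2 V))) (Fix N : C → Set (Sym2 V))
    (hcover : ∀ T ∈ D, ∃ c, ∀ e ∈ Fix c, (e ∈ T ↔ e ∈ N c))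
    (hinside : ∀ c (T : Set (Sym2 V)), (∀ e ∈ Fix c, (e ∈ T ↔ e ∈ N c)) → T ∈ D)
    (huniq : ∀ c c' (T : Set (Sym2 V)), (∀ e ∈ Fix c, (e ∈ T ↔ e ∈ N c)) → (∀ e ∈ Fix c', (e ∈ T ↔ e ∈ N c')) → c = c')
    (hdom : ∀ c (T T' : Set (Sym2 V)), (∀ e ∈ Fix c, (e ∈ T ↔ e ∈ N c)) → (∀ e ∈ Fix c, (e ∈ T' ↔ e ∈ N c)) →
      (∀ e ∉ Fix c, (e ∈ T' ↔ e ∉ T)) → openCluster (T'ᶜ ∩ E) s ⊆ openCluster (T ∩ E) s)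
    {K₁ K₂ : Set V → Set V → ℝ}
    (hK₁ : ∀ ⦃P P' Q Q' : Set V⦄, P ⊆ P' → Q' ⊆ Q → K₁ P Q ≤ K₁ P' Q') (hso₁ : ∀ P Q, 0 ≤ K₁ P Q + K₁ Q P)
    (hK₂ : ∀ ⦃P P' Q Q' : Set V⦄, P ⊆ P' → Q' ⊆ Q → K₂ P Q ≤ K₂ P' Q') (hso₂ : ∀ P Q, 0 ≤ K₂ P Q + K₂ Q P) :
    0 ≤ ∑ T ∈ D, K₁ (openCluster (T ∩ E) s) (openCluster (Tᶜ ∩ E) s) * K₂ (openCluster (T ∩ E) s) (openCluster (Tᶜ ∩ E) s) := by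
  let mem : C → Set (Sym2 V) → Prop := fun c T => ∀ e ∈ Fix c, (e ∈ T ↔ e ∈ N c)
  let Ψ : Set (Sym2 V) → ℝ := fun T =>
    K₁ (openCluster (T ∩ E) s) (openCluster (Tᶜ ∩ E) s) * K₂ (openCluster (T ∩ E) s) (openCluster (Tᶜ ∩ E) s)
  -- the part of a colouring: its box (if it lies in `D`)
  let P : Set (Sym2 V) → Finset (Set (Sym2 V)) := fun T =>
    if h : T ∈ D then Finset.univ.filter (fun M => mem (Classical.choose (hcover T h)) M) else ∅
  have hP : ∀ T ∈ D, ∃ c, mem c T ∧ P T = Finset.univ.filter (fun M => mem c M) := by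
    intro T hT
    refine ⟨Classical.choose (hcover T hT), Classical.choose_spec (hcover T hT), ?_⟩
    simp only [P, dif_pos hT]
  refine sum_nonneg_of_parts D Ψ P ?_ ?_ ?_ ?_
  · intro T hT
    obtain ⟨c, hmem, hPT⟩ := hP T hT
    rw [hPT]
    exact Finset.mem_filter.2 ⟨Finset.mem_univ _, hmem⟩
  · intro T hT M hM
    obtain ⟨c, -, hPT⟩ := hP T hT
    rw [hPT] at hM
    exact hinside c M (Finset.mem_filter.1 hM).2
  · intro T hT M hM
    obtain ⟨c, -, hPT⟩ := hP T hT
    rw [hPT] at hM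
    have hMc : mem c M := (Finset.mem_filter.1 hM).2
    have hMD : M ∈ D := hinside c M hMc
    obtain ⟨c', hMc', hPM⟩ := hP M hMD
    rw [hPM, hPT, huniq c' c M hMc' hMc]
  · intro T hT
    obtain ⟨c, -, hPT⟩ := hP T hT
    rw [hPT]
    exact box_sum_nonneg E s (Fix c) (N c) (hdom c) hK₁ hso₁ hK₂ hso₂

section Leaf

variable {E : Set (Sym2 V)} {s Q w : V}

omit [Fintype V] in
open Pendant in
/-- **Boxes survive a pendant pair: red domination.**  `w` a leaf (meeting only loops of `E`) attached by the free pair `Qw` (`Q ≠ w`,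
`s ≠ w`): if `T, T'` are opposite at `Qw` and `Y_E T' ⊆ X_E T`, then `Y_{E ∪ {Qw}} T' ⊆ X_{E ∪ {Qw}} T`. [this work] -/
theorem dom_insert_leaf (hw : ∀ f ∈ E, w ∈ f → f.IsDiag) (hQw : Q ≠ w) (hsw : s ≠ w) {T T' : Set (Sym2 V)}
    (hflip : s(Q, w) ∈ T' ↔ s(Q, w) ∉ T) (hdom : openCluster (T'ᶜ ∩ E) s ⊆ openCluster (T ∩ E) s) :
    openCluster (T'ᶜ ∩ insert s(Q, w) E) s ⊆ openCluster (T ∩ insert s(Q, w) E) s := by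
  intro u hu
  by_cases huw : u = w
  · subst huw
    have h1 := (reachable_col_leaf_iff hw hQw hsw T'ᶜ).1 hu
    have hred : s(Q, u) ∈ T := by
      by_contra h
      exact h1.1 (hflip.2 h)
    have hQ : Q ∈ openCluster (T ∩ E) s := hdom h1.2
    exact (reachable_col_leaf_iff hw hQw hsw T).2 ⟨hred, hQ⟩
  · have h1 : u ∈ openCluster (T'ᶜ ∩ E) s := (reachable_col_iff hw hQw hsw T'ᶜ huw).1 hu
    exact (reachable_col_iff hw hQw hsw T huw).2 (hdom h1)

omit [Fintype V] in
open Pendant in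
/-- **Boxes survive a pendant pair: the event.**  For `P ≠ w`, `P ∈ X_{E ∪ {Qw}} T ↔ P ∈ X_E T`. [this work] -/
theorem mem_insert_leaf_iff (hw : ∀ f ∈ E, w ∈ f → f.IsDiag) (hQw : Q ≠ w) (hsw : s ≠ w) {P : V} (hPw : P ≠ w) (T : Set (Sym2 V)) :
    P ∈ openCluster (T ∩ insert s(Q, w) E) s ↔ P ∈ openCluster (T ∩ E) s :=
  reachable_col_iff hw hQw hsw T hPw

end Leaf

section Path

variable {E : Set (Sym2 V)} {s : V} {w : ℕ → V} {b : ℕ}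
  (hfresh : ∀ i, 0 < i → i ≤ b → ∀ f ∈ E, w i ∈ f → f.IsDiag)
  (hwinj : ∀ i j, i ≤ b → j ≤ b → w i = w j → i = j) (hsw : ∀ i, 0 < i → i ≤ b → s ≠ w i)

omit [Fintype V] in
/-- `Cyc.edgeSet (j+1) w = Cyc.edgeSet j w ∪ {w j w (j+1)}` (the path grows by one pair). -/
theorem union_edgeSet_succ (E : Set (Sym2 V)) (w : ℕ → V) (j : ℕ) :
    E ∪ Cyc.edgeSet (j + 1) w = insert s(w j, w (j + 1)) (E ∪ Cyc.edgeSet j w) := by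
  ext e
  simp only [Cyc.edgeSet, Cyc.edge, Set.mem_union, Set.mem_setOf_eq, Set.mem_insert_iff]
  constructor
  · rintro (h | ⟨i, hi, rfl⟩)
    · exact Or.inr (Or.inl h)
    · by_cases hij : i = j
      · subst hij; exact Or.inl rfl
      · exact Or.inr (Or.inr ⟨i, by omega, rfl⟩)
  · rintro (rfl | h | ⟨i, hi, rfl⟩)
    · exact Or.inr ⟨j, Nat.lt_succ_self j, rfl⟩
    · exact Or.inl h
    · exact Or.inr ⟨i, Nat.lt_succ_of_lt hi, rfl⟩

omit [Fintype V] in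
/-- `E ∪ Cyc.edgeSet 0 w = E`. -/
theorem union_edgeSet_zero (E : Set (Sym2 V)) (w : ℕ → V) : E ∪ Cyc.edgeSet 0 w = E := by
  ext e
  simp only [Cyc.edgeSet, Set.mem_union, Set.mem_setOf_eq]
  constructor
  · rintro (h | ⟨i, hi, -⟩)
    · exact h
    · omega
  · exact fun h => Or.inl h

include hfresh hwinj in
omit [Fintype V] in
/-- Along a pendant path of fresh vertices, the next vertex `w (j+1)` is a leaf of `E ∪ Cyc.edgeSet j w`. [this work] -/
theorem leaf_path {j : ℕ} (hj : j < b) : ∀ f ∈ E ∪ Cyc.edgeSet j w, w (j + 1) ∈ f → f.IsDiag := by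
  rintro f (hf | ⟨i, hi, rfl⟩) hw
  · exact hfresh (j + 1) (Nat.succ_pos j) hj f hf hw
  · exfalso
    rcases Sym2.mem_iff.1 hw with h | h
    · have := hwinj (j + 1) i hj (by omega) h; omega
    · have := hwinj (j + 1) (i + 1) hj (by omega) h; omega

include hfresh hwinj hsw in
omit [Fintype V] in
/-- **The event survives a pendant path**: for `u` off the path, `u ∈ X_{E ∪ path_j} T ↔ u ∈ X_E T` (`j ≤ b`). [this work] -/
theorem mem_path_iff {j : ℕ} (hj : j ≤ b) (T : Set (Sym2 V)) {u : V} (hu : ∀ i, 0 < i → i ≤ b → u ≠ w i) :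
    u ∈ openCluster (T ∩ (E ∪ Cyc.edgeSet j w)) s ↔ u ∈ openCluster (T ∩ E) s := by
  induction j with
  | zero => rw [union_edgeSet_zero]
  | succ j ih =>
    rw [union_edgeSet_succ, mem_insert_leaf_iff (leaf_path hfresh hwinj (Nat.lt_of_succ_le hj))
      (fun h => absurd (hwinj j (j + 1) (by omega) hj h) (by omega)) (hsw (j + 1) (Nat.succ_pos j) hj)
      (hu (j + 1) (Nat.succ_pos j) hj)]
    exact ih (Nat.le_of_succ_le hj)

include hfresh hwinj hsw in
omit [Fintype V] in
/-- **Red domination survives a pendant path**: if `T, T'` are opposite on the path pairs and `Y_E T' ⊆ X_E T`, then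
`Y_{E ∪ path_j} T' ⊆ X_{E ∪ path_j} T` (`j ≤ b`). [this work] -/
theorem dom_path {j : ℕ} (hj : j ≤ b) {T T' : Set (Sym2 V)} (hflip : ∀ i, i < j → (s(w i, w (i + 1)) ∈ T' ↔ s(w i, w (i + 1)) ∉ T))
    (hdom : openCluster (T'ᶜ ∩ E) s ⊆ openCluster (T ∩ E) s) :
    openCluster (T'ᶜ ∩ (E ∪ Cyc.edgeSet j w)) s ⊆ openCluster (T ∩ (E ∪ Cyc.edgeSet j w)) s := by
  induction j with
  | zero => rw [union_edgeSet_zero]; exact hdom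
  | succ j ih =>
    rw [union_edgeSet_succ]
    exact dom_insert_leaf (leaf_path hfresh hwinj (Nat.lt_of_succ_le hj))
      (fun h => absurd (hwinj j (j + 1) (by omega) hj h) (by omega)) (hsw (j + 1) (Nat.succ_pos j) hj)
      (hflip j (Nat.lt_succ_self j)) (ih (Nat.le_of_succ_le hj) fun i hi => hflip i (Nat.lt_succ_of_lt hi))

end Path

end Box

end Antithetic

end Summit.CriticalPhenomena.PercolationContinuityZ3.Theorems
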